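import Mathlib.Analysis.InnerProductSpace.PiL2
import Mathlib.Analysis.Normed.Group.FunctionSeries
import Mathlib.Data.Set.Card
import Literature.MathematicalPhysics.StatisticalMechanics.Theil2006PeriodicMinimumDistance
import Literature.MathematicalPhysics.StatisticalMechanics.Theil2006LatticeCharacterization
import Literature.MathematicalPhysics.StatisticalMechanics.Theil2006DiscreteImbedding
import Literature.MathematicalPhysics.StatisticalMechanics.Theil2006Periodic
import Literature.MathematicalPhysics.StatisticalMechanics.Theil2006RenormalizedPotential
import HarnessLib

/-!
# Theil 2006, Theorem 1.2 — the end of its proof (§3, p. 14): periodic ground states are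
defect-free unit-bond configurations and rigid motions of `A₂`, from the main estimate (44);
existence of minimizers of the relaxed periodic problem

Topic `Literature/MathematicalPhysics/StatisticalMechanics`; companion of `Theil2006.lean` (the
model), `Theil2006Periodic.lean` (Theorem 1.2 and its corrected form
`Theil2006_periodicGroundStates_upToRotation`), `Theil2006PeriodicMinimumDistance.lean`
(Lemma 3.1, `IsPeriodicSet`, `relaxedPeriodicEnergy`, `cellEquiv`),
`Theil2006LatticeCharacterization.lean` ((42) ∧ (43) ⇒ `RΩ + τ = A₂`),
`Theil2006DiscreteImbedding.lean` (`𝒮`, `𝒩(x)`, `∂X` for arbitrary index types) and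
`Theil2006RenormalizedPotential.lean` ((1), Lemma 2.1 (10): `V_* ≥ -1 + ¼ (r-1)²` near `1`).
Everything in this file is PROVED (no `sorry`, no named fact introduced or discharged; D-0026);
the definitions have bodies.

## Source, as printed

F. Theil, *A proof of crystallization in two dimensions*, Comm. Math. Phys. **262** (2006)
209–236, §3 *Proof of Theorem 1.2* (read in the author's accepted preprint of 26 Aug 2005, same
numbering, pp. 13–14; lit store `paper:url-69bff4ce1e30`).

p. 13: "Let `L ∈ ℕ`; a set `X ⊂ A₂` is `L`-periodic if `X + LA₂ = X`. We introduce the equivalence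
relation `∼` on the set of subset `ω` an `L`-periodic set `X`: `ω ∼ ω'` if there is a vector
`τ ∈ LA₂` such that `ω' = ω + τ`. […] For a `L`-periodic map the defects `∂X`, neighbors `𝒮` and
the equilateral simplices `𝒯_λ` are periodic sets and we can define the natural quotient sets
`X̃ := X/∼`, `∂X̃ := ∂X/∼`, `𝒮̃ := 𝒮/∼`, `𝒫̃ := 𝒫/∼`, `𝒯̃_λ := 𝒯_λ/∼`. […] If `X ⊂ A₂` is
`L`-periodic we set `E_L^per(X, {y}) := ∑_{{p ⊂ X | #p = 2}/∼} e(p)`. Clearly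
`E_L^per(X, ·) = E_L^per(·)` (defined in Theorem 1.2) if `X = A₂`. Furthermore, since there are
only `2^{L²}` possible `L`-periodic sets `X`, a minimizer `(X_min, y_min)` of `E_L^per` exists."
[Lemma 3.1: (13) for all such minimizers — `Theil2006.periodicMinimumDistance`.]

p. 14: "We claim now that for configurations `X, y` which satisfy the bound (13) a suitably
adapted version of (9) holds:
(44) `E_L^per(X, {y}) ≥ (1/C) ∑_{{x,x'} ∈ 𝒮̃} (e_*({x,x'}) − 1) + ¼ #∂X̃ − 3 #X̃.`
The proof of Theorem 1.1 can be adapted to the periodic setting by simply replacing the sets `X`,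
`∂X`, `𝒮`, `𝒯_λ` with the corresponding quotient sets `X̃`, `∂X̃`, `𝒮̃`, `𝒯̃_λ` and the elements of
those quotient sets by representatives.
  As the identity map `y(x) ≡ x` is `L`-periodic for every `L ∈ ℕ` and therefore an admissible
competitor we obtain that `E_L^per(X_min, {y_min}) + 3L² ≤ 0` and together with (44)
`0 ≥ (1/C) ∑_{{x,x'} ∈ 𝒮̃} (e_*({x,x'}) + 1) + ¼ #∂X̃_min + 3(L² − #X̃_min)`.
Since `#X̃ ≤ L²` this estimate shows that `#X̃_min = L²`, `∂X̃_min = ∅`, and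
`|y_min(x) − y_min(x')| = 1` for all `{x,x'} ∈ 𝒮`.
  Hence, the set `Ω = {y_min(x) | x ∈ A₂}` satisfies (42) and (43) and consequentially
`RΩ + τ = A₂` for a rotation `R ∈ SO(2)` and a translation `τ ∈ ℝ²`. By the periodicity of `y_min`
we can choose `R = Id`, this is precisely the claim and the proof of Theorem 1.2 is finished."
[(42): `min_{y ≠ y' ∈ Ω} |y − y'| ≥ 1`; (43): `#{y' ∈ Ω | |y − y'| ≤ 1} = 7` for all `y ∈ Ω`; the
last sentence over-claims — `Theil2006Periodic.lean` — and the statement proved is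
`Theil2006_periodicGroundStates_upToRotation`.]

## What is here

* The quotient sets by representatives in the period cell `A₂ ∩ LU` (`Fin L × Fin L`, `cellPoint`):
  `Theil2006.cellClasses L X` (`X̃`), `Theil2006.defectClasses α L X y` (`∂X̃`: representatives
  `x ∈ X` with `#(X ∩ 𝒩(x)) ≠ 7`), `Theil2006.shortBondSum α L X y f` (the ORDERED sum over `𝒮̃` of
  a radial bond quantity: every representative paired with all its `𝒮`-neighbours in `X`, i.e.
  twice the printed class sum — the convention of `relaxedPeriodicEnergy`/`periodicEnergy`),
  `Theil2006.mainEstimateRHS C α V L X y` (the right-hand side of (44) in the PRINTED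
  normalisation, to be compared with `relaxedPeriodicEnergy V L X y / 2`), and
  `Theil2006.IsRelaxedMinimizer V L X y` ("a minimizer `(X_min, y_min)` of `E_L^per(·,·)`").
* `Theil2006.exists_eq_one_of_renormalizedPotential_eq` — a short bond (`r ∈ (1−α, 1+α]`) with
  `e_* = V_*(r) = −1` has `r = 1` ((1) and Lemma 2.1 (10), via
  `exists_quadratic_le_renormalizedPotential`; the right end point by continuity of `V_*`).
* `Theil2006.vanishing_of_mainEstimate` — "Since `#X̃ ≤ L²` this estimate shows that
  `#X̃_min = L²`, `∂X̃_min = ∅`, and [`e_* = −1` on `𝒮`]" for any periodic `(X, y)` with energy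
  `≤` that of the identity competitor (`IsNormalized.relaxedPeriodicEnergy_univ_triPoint`:
  `E_L^per(A₂, id) = −6L²`, i.e. `−3L²` printed) which satisfies (44).
* `Theil2006.exists_structure_of_isRelaxedMinimizer` — for a relaxed minimizer satisfying (44):
  `X = A₂`, no defects, all short bonds of length exactly `1`, and (13) (Lemma 3.1), transported
  from representatives to all of `A₂` by periodicity (`IsPeriodic.nbhdSet_add_zsmul`, …).
* `Theil2006.local_conditions_of_structure` — "Hence, the set `Ω = {y_min(x) | x ∈ A₂}` satisfies (42) and
  (43)".
* `Theil2006.mainEstimateRHS_univ_triPoint` — consistency check: on the undeformed lattice both sides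
  of (44) equal `−3L²` (the rendering's constants and normalisations are the printed ones).
* `Theil2006.exists_rotation_range_eq_of_mainEstimate` — **the end of the proof of Theorem 1.2**:
  under (44) (for all `L`-periodic `(X, y)` satisfying (13), with some `C > 0`) and the existence
  of a relaxed minimizer, EVERY ground state `y` of `E_L^per` over `Y_L^per` has an image
  satisfying (42), (43), hence `RΩ + τ = A₂` with `det R = 1`
  (`exists_rotation_range_eq_triangularLattice`). The printed text treats "the" minimizer; the
  transfer to an arbitrary ground state `y` is the one implicit step: the relaxed minimizer
  `(X₀, y₀)` has `X₀ = A₂`, so `E_L^per(y) ≤ E_L^per(y₀) = min E_L^per(·,·)` and `(A₂, y)` is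
  itself a relaxed minimizer.
* `Theil2006.exists_isRelaxedMinimizer` — **the existence assertion of p. 13, PROVED for
  admissible `V` that are continuous on `[0, ∞)`**: `E_L^per(X, {·})` is a continuous function of
  the cell data `u ∈ (ℝ²)^{A₂ ∩ LU}` (`Theil2006.periodicExtend`; rows are uniformly dominated
  series on balls, `continuous_rowEnergy_periodicExtend`), invariant under classwise shifts by `L A₂`
  (`relaxedPeriodicEnergy_shift`: such a shift is a relabelling `Theil2006.classShift` of the
  particles), so it attains its minimum on the compact fundamental domain `{‖u(x)‖ ≤ 2L}`
  (`exists_norm_add_smul_triPoint_le`), and there are finitely many `X`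
  (`Theil2006.setOfClasses`, `IsPeriodicSet.eq_setOfClasses`). Hence
  `Theil2006.exists_rotation_range_eq_of_mainEstimate_of_continuousOn`: for continuous admissible
  `V`, (44) ALONE gives the conclusion of Theorem 1.2 for every periodic ground state.
* `Theil2006_periodicGroundStates_upToRotation_of_mainEstimate` — the named fact
  `Theil2006_periodicGroundStates_upToRotation` reduced to (44) and the existence assertion, in
  the style of `Theil2006_groundStateEnergy_of_lower_bound` (`Theil2006EnergyBounds.lean`).

## Rendering notes

* **The sign in (44).** The print has "`(e_*({x,x'}) − 1)`" in (44); the display that follows it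
  on the same page ("… together with (44) `0 ≥ (1/C) ∑ (e_*({x,x'}) + 1) + …`") and the
  finite-`N` estimate (9)/(39) it adapts (`−#𝒮 + (1/C) ∑_{𝒮} (|y(x) − y(x')| − 1)²`, a
  NON-NEGATIVE correction) only make sense with "`+ 1`": `e_* + 1 ≥ 0` by (1)
  (`IsNormalized.neg_one_le_renormalizedPotential`), with equality exactly on bonds of length `1`.
  `mainEstimateRHS` therefore carries `e_* + 1`; with the printed `− 1` the displayed conclusion
  would not follow. (Recorded as a misprint by the reading seat, 2026-08-24.)
* **Normalisation.** `relaxedPeriodicEnergy` (like `periodicEnergy`, = the printed `E_L^per` of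
  Theorem 1.2) is the ordered double sum, twice the class sum of p. 13; (44) is accordingly the
  inequality `mainEstimateRHS C α V L X y ≤ relaxedPeriodicEnergy V L X y / 2`, and the identity
  competitor has energy `−6L²`. `C` may depend on `α, L, V` here (the paper's `C` is universal —
  a stronger hypothesis than we need).
* **(44) is a hypothesis, not a fact.** Its proof is the whole proof of (9) (Lemma 2.7,
  Propositions 2.8/2.9, (29)–(41), Propositions 4.1/4.3/4.8) run on quotient sets, not yet in the
  tree; it enters the theorems below as an explicit hypothesis on the data `(α, L, V, C)`, stated
  with the tree's definitions, and is NOT vendored as a named fact.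
* **Existence of the relaxed minimizer** is asserted on p. 13 without proof. We prove it for
  `V` continuous on `[0, ∞)` (`exists_isRelaxedMinimizer`); the hypotheses (1)–(5) of
  `Theil2006.IsAdmissible` (real-valued `V`, `C²` on `(1−α, ∞)`, only the inequality (2) on
  `[0, 1−α]`) do not include continuity at `1 − α`, and our compactness argument uses it, so for
  general admissible `V` the printed assertion is kept as an explicit hypothesis
  (`exists_rotation_range_eq_of_mainEstimate`, `…_of_mainEstimate`). `-- TODO(general V)`: none
  needed downstream at present.
* (42) is rendered pairwise on labels (`y x ≠ y x' → 1 ≤ dist (y x) (y x')`), (43) with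
  `Set.ncard`, exactly as in `Theil2006LatticeCharacterization.lean`; "rotation `R ∈ SO(2)`" is a
  linear isometry equivalence with `LinearMap.det R = 1`.
-/

noncomputable section

open scoped BigOperators Topology
open Filter Set Metric

namespace Literature.MathematicalPhysics.StatisticalMechanics

namespace Theil2006

/-! ### The quotient sets `X̃`, `∂X̃`, `𝒮̃` of an `L`-periodic configuration, by representatives -/

section Quotients

variable {α : ℝ} {L : ℕ} {X : Set (ℤ × ℤ)} {y : ℤ × ℤ → Plane}

open scoped Classical in
/-- The representatives in the period cell `A₂ ∩ LU` of the quotient set `X̃ := X/∼` of an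
`L`-periodic set `X ⊂ A₂` (so `#X̃ = (cellClasses L X).card`). [cite: Theil2006, §3 (quotient sets `X̃ := X/∼`, preprint p. 13)] -/
def cellClasses (L : ℕ) (X : Set (ℤ × ℤ)) : Finset (Fin L × Fin L) :=
  Finset.univ.filter fun c => cellPoint c ∈ X

/-- Membership in `X̃` by representatives. [cite: Theil2006, §3 (preprint p. 13)] -/
theorem mem_cellClasses {c : Fin L × Fin L} : c ∈ cellClasses L X ↔ cellPoint c ∈ X := by
  classical
  simp [cellClasses]

/-- `#X̃ ≤ L²` ("Since `#X̃ ≤ L²` …", p. 14). [cite: Theil2006, §3 Proof of Theorem 1.2 (preprint p. 14)] -/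
theorem card_cellClasses_le : ((cellClasses L X).card : ℝ) ≤ (L : ℝ) ^ 2 := by
  have h : (cellClasses L X).card ≤ (Finset.univ : Finset (Fin L × Fin L)).card :=
    Finset.card_le_univ _
  rw [Finset.card_univ, Fintype.card_prod, Fintype.card_fin] at h
  have : ((cellClasses L X).card : ℝ) ≤ ((L * L : ℕ) : ℝ) := by exact_mod_cast h
  simpa [sq] using this

/-- `A₂` has all `L²` classes. [cite: Theil2006, §3 (preprint p. 13)] -/
theorem cellClasses_univ (L : ℕ) : cellClasses L (univ : Set (ℤ × ℤ)) = Finset.univ := by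
  ext c
  simp [mem_cellClasses]

/-- An `L`-periodic set containing every cell representative is all of `A₂` (`#X̃ = L²` ⇒
`X = A₂`). [cite: Theil2006, §3 Proof of Theorem 1.2 («#X̃_min = L²», preprint p. 14)] -/
theorem IsPeriodicSet.eq_univ_of_cellClasses_eq (hL : 0 < L) (hX : IsPeriodicSet L X)
    (h : cellClasses L X = Finset.univ) : X = univ := by
  refine eq_univ_of_forall fun k => ?_
  rw [hX.mem_iff_cellPoint_mem hL k, ← mem_cellClasses, h]
  exact Finset.mem_univ _

open scoped Classical in
/-- The representatives of the quotient set of defects `∂X̃ := ∂X/∼`: cell representatives `x ∈ X`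
whose neighbourhood inside `X`, `X ∩ 𝒩(x)`, does not have exactly seven elements (`#` = `Set.ncard`;
for `X = A₂` this is `x ∈ ∂X(y)`, `mem_defectClasses_univ`). [cite: Theil2006, §3 (quotient sets `∂X̃ := ∂X/∼`, preprint p. 13)] -/
def defectClasses (α : ℝ) (L : ℕ) (X : Set (ℤ × ℤ)) (y : ℤ × ℤ → Plane) : Finset (Fin L × Fin L) :=
  (cellClasses L X).filter fun c => (X ∩ nbhdSet α y (cellPoint c)).ncard ≠ 7

/-- Membership in `∂X̃` by representatives. [cite: Theil2006, §3 (preprint p. 13)] -/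
theorem mem_defectClasses {c : Fin L × Fin L} :
    c ∈ defectClasses α L X y ↔ cellPoint c ∈ X ∧ (X ∩ nbhdSet α y (cellPoint c)).ncard ≠ 7 := by
  classical
  simp [defectClasses, mem_cellClasses]

/-- For `X = A₂` the defect classes are the cell representatives lying in `∂X(y)`.
[cite: Theil2006, §2.1 (definition of ∂X(y), preprint p. 4) and §3 (preprint p. 13)] -/
theorem mem_defectClasses_univ {c : Fin L × Fin L} :
    c ∈ defectClasses α L (univ : Set (ℤ × ℤ)) y ↔ cellPoint c ∈ defectSet α y := by
  rw [mem_defectClasses, mem_defectSet_iff, univ_inter]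
  simp

/-- **The ordered sum over the quotient set of short bonds `𝒮̃ := 𝒮/∼`** of a radial bond
quantity `f(|y(x) − y(x')|)`: every cell representative `x ∈ X ∩ LU` is paired with all its
`𝒮`-neighbours `x' ∈ X` (a `finsum`; the neighbour sets are finite for periodic `y`,
`IsPeriodic.finite_shortRange`). Each class `{x, x'} ∈ 𝒮̃` is met exactly twice (once from each
end), so this is twice the printed `∑_{{x,x'} ∈ 𝒮̃}` — the same convention as
`relaxedPeriodicEnergy`. [cite: Theil2006, §3 (44) (preprint p. 14)] -/
def shortBondSum (α : ℝ) (L : ℕ) (X : Set (ℤ × ℤ)) (y : ℤ × ℤ → Plane) (f : ℝ → ℝ) : ℝ :=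
  ∑ c ∈ cellClasses L X,
    ∑ᶠ x' ∈ {x' | x' ∈ X ∧ IsShortRange α y (cellPoint c) x'}, f (dist (y (cellPoint c)) (y x'))

/-- **The right-hand side of (44)** in the printed normalisation:
`(1/C) ∑_{{x,x'} ∈ 𝒮̃} (e_*({x,x'}) + 1) + ¼ #∂X̃ − 3 #X̃`, `e_*({x,x'}) = V_*(|y(x) − y(x')|)`.
The print has "`(e_*({x,x'}) − 1)`" in (44); the very next display (p. 14, "… together with (44)
`0 ≥ (1/C) ∑ (e_*({x,x'}) + 1) + ¼ #∂X̃_min + 3(L² − #X̃_min)`") and the finite-`N` estimates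
(9)/(39) it adapts (`+ (1/C) ∑ (|y(x) − y(x')| − 1)² ≥ 0`) show that `+ 1` is meant (`e_* + 1 ≥ 0`
by (1), `= 0` exactly on bonds of length `1`); we render the intended sign.
[cite: Theil2006, §3 (44) and the display following it (preprint p. 14)] -/
def mainEstimateRHS (C α : ℝ) (V : ℝ → ℝ) (L : ℕ) (X : Set (ℤ × ℤ)) (y : ℤ × ℤ → Plane) : ℝ :=
  1 / C * (shortBondSum α L X y (fun r => renormalizedPotential V r + 1) / 2) +
    1 / 4 * ((defectClasses α L X y).card : ℝ) - 3 * ((cellClasses L X).card : ℝ)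

/-- **Minimizers of the relaxed periodic problem** (p. 13: "a minimizer `(X_min, y_min)` of
`E_L^per`"): an `L`-periodic `X ⊂ A₂` and `y ∈ Y_L^per` of least relaxed energy
`E_L^per(X, {y})` among all such pairs. [cite: Theil2006, §3 (preprint p. 13)] -/
def IsRelaxedMinimizer (V : ℝ → ℝ) (L : ℕ) (X : Set (ℤ × ℤ)) (y : ℤ × ℤ → Plane) : Prop :=
  IsPeriodicSet L X ∧ IsPeriodic L y ∧
    ∀ (X' : Set (ℤ × ℤ)) (y' : ℤ × ℤ → Plane), IsPeriodicSet L X' → IsPeriodic L y' →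
      relaxedPeriodicEnergy V L X y ≤ relaxedPeriodicEnergy V L X' y'

end Quotients

/-! ### Periodicity transports short bonds and neighbourhoods along `L A₂` -/

section Transport

variable {α : ℝ} {L : ℕ} {y : ℤ × ℤ → Plane}

/-- Distances between particles are `L A₂`-periodic in the labels. [cite: Theil2006, §3 («for a L-periodic map the defects ∂X, neighbors 𝒮 … are periodic sets», preprint p. 13)] -/
theorem IsPeriodic.dist_add_zsmul (hy : IsPeriodic L y) (k k' g : ℤ × ℤ) :
    dist (y (k + (L : ℤ) • g)) (y (k' + (L : ℤ) • g)) = dist (y k) (y k') := by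
  rw [hy.apply_add_zsmul, hy.apply_add_zsmul, dist_add_right]

/-- `𝒮` is a periodic set of pairs. [cite: Theil2006, §3 (preprint p. 13)] -/
theorem IsPeriodic.isShortRange_add_zsmul_iff (hy : IsPeriodic L y) (k k' g : ℤ × ℤ) :
    IsShortRange α y (k + (L : ℤ) • g) (k' + (L : ℤ) • g) ↔ IsShortRange α y k k' := by
  unfold IsShortRange
  rw [hy.dist_add_zsmul]

/-- `𝒩(x + Lg) = 𝒩(x) + Lg`. [cite: Theil2006, §3 (preprint p. 13)] -/
theorem IsPeriodic.nbhdSet_add_zsmul (hy : IsPeriodic L y) (k g : ℤ × ℤ) :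
    nbhdSet α y (k + (L : ℤ) • g) = (fun k' => k' + (L : ℤ) • g) '' nbhdSet α y k := by
  ext k'
  simp only [mem_image, mem_nbhdSet_iff]
  constructor
  · intro h
    refine ⟨k' - (L : ℤ) • g, ?_, by abel⟩
    rcases h with h | h
    · exact Or.inl (by rw [h]; abel)
    · right
      rw [← hy.isShortRange_add_zsmul_iff k (k' - (L : ℤ) • g) g]
      simpa using h
  · rintro ⟨k'', h, rfl⟩
    rcases h with rfl | h
    · exact Or.inl rfl
    · exact Or.inr ((hy.isShortRange_add_zsmul_iff k k'' g).2 h)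

/-- `#𝒩(x + Lg) = #𝒩(x)`: `∂X` is a periodic set. [cite: Theil2006, §3 (preprint p. 13)] -/
theorem IsPeriodic.ncard_nbhdSet_add_zsmul (hy : IsPeriodic L y) (k g : ℤ × ℤ) :
    (nbhdSet α y (k + (L : ℤ) • g)).ncard = (nbhdSet α y k).ncard := by
  rw [hy.nbhdSet_add_zsmul, Set.ncard_image_of_injective _ (add_left_injective _)]

/-- The `𝒮`-neighbours of a particle of a periodic configuration form a finite set (they lie in
the disc of radius `1 + α`; `IsPeriodic.finite_dist_le`). [cite: Theil2006, §2.1 (𝒮(y), preprint p. 4) and §3 (p. 13); our lemma] -/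
theorem IsPeriodic.finite_shortRange (hL : 0 < L) (hy : IsPeriodic L y) (X : Set (ℤ × ℤ))
    (k : ℤ × ℤ) : {x' | x' ∈ X ∧ IsShortRange α y k x'}.Finite :=
  (hy.finite_dist_le hL (y k) (1 + α)).subset fun x' hx' => by
    rw [mem_setOf_eq, dist_comm]
    exact hx'.2.dist_le

end Transport

/-! ### `e_* = -1` only on bonds of length `1` ((1) with Lemma 2.1 (10)) -/

section UnitBonds

variable {α : ℝ} {V : ℝ → ℝ}

/-- **A short bond of renormalized energy exactly `-1` has length exactly `1`.** There is a
universal `α₀ > 0` such that for `α ∈ (0, α₀)`, `V` admissible and `r ∈ (1 − α, 1 + α]`,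
`V_*(r) = −1` forces `r = 1`: by (1) and Lemma 2.1 (10), `V_*(r) ≥ −1 + ¼ (r − 1)²` on the window
(`exists_quadratic_le_renormalizedPotential`), extended to the right end point by continuity of
`V_*`. This is the step "`∑ (e_* + 1) = 0` ⇒ `|y_min(x) − y_min(x')| = 1` for all
`{x,x'} ∈ 𝒮`" of p. 14. [cite: Theil2006, §3 Proof of Theorem 1.2 (preprint p. 14), with §1 (1) and §2.2 Lemma 2.1 (10)] -/
theorem exists_eq_one_of_renormalizedPotential_eq :
    ∃ α₀ : ℝ, 0 < α₀ ∧ ∀ (α : ℝ) (V : ℝ → ℝ), 0 < α → α < α₀ → IsAdmissible α V →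
      ∀ r : ℝ, 1 - α < r → r ≤ 1 + α → renormalizedPotential V r = -1 → r = 1 := by
  obtain ⟨αq, hαq, hquad⟩ := exists_quadratic_le_renormalizedPotential
  refine ⟨min αq (1 / 5), lt_min hαq (by norm_num), fun α V hα hα' hV r hr1 hr2 heq => ?_⟩
  have hαq' : α < αq := hα'.trans_le (min_le_left _ _)
  have hα5 : α ≤ 1 / 5 := hα'.le.trans (min_le_right _ _)
  rcases lt_or_eq_of_le hr2 with hlt | hEq
  · have hq := hquad α V hα hαq' hV r ⟨hr1, hlt⟩
    rw [heq] at hq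
    nlinarith [sq_nonneg (r - 1)]
  · -- `r = 1 + α`: `V_*(1+α) ≥ -1 + α²/16` by continuity from the left
    exfalso
    have hcont : ContinuousAt (renormalizedPotential V) (1 + α) :=
      (hV.hasDerivAt_renormalizedPotential hα5 (by linarith)).continuousAt
    have hlim : Tendsto (renormalizedPotential V) (𝓝[<] (1 + α))
        (𝓝 (renormalizedPotential V (1 + α))) :=
      hcont.tendsto.mono_left nhdsWithin_le_nhds
    have hev : ∀ᶠ s in 𝓝[<] (1 + α), -1 + α ^ 2 / 16 ≤ renormalizedPotential V s := by
      filter_upwards [Ioo_mem_nhdsLT (show 1 + α / 2 < 1 + α by linarith)] with s hs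
      have hq := hquad α V hα hαq' hV s ⟨by linarith [hs.1], hs.2⟩
      nlinarith [hs.1]
    have hge := ge_of_tendsto hlim hev
    rw [← hEq, heq] at hge
    nlinarith

end UnitBonds

/-! ### The end of the proof of Theorem 1.2 (p. 14) -/

section EndOfProof

variable {α : ℝ} {V : ℝ → ℝ} {L : ℕ} {X : Set (ℤ × ℤ)} {y : ℤ × ℤ → Plane}

/-- **The identity competitor**: `E_L^per(A₂, {x ↦ x}) = -6 L²` (`= -3 L²` in the printed
normalisation): "As the identity map `y(x) ≡ x` is `L`-periodic for every `L ∈ ℕ` and therefore an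
admissible competitor …". [cite: Theil2006, §3 Proof of Theorem 1.2 (preprint p. 14)] -/
theorem IsNormalized.relaxedPeriodicEnergy_univ_triPoint (hV : IsNormalized V) (L : ℕ) :
    relaxedPeriodicEnergy V L univ triPoint = -6 * (L : ℝ) ^ 2 := by
  rw [relaxedPeriodicEnergy_univ, hV.periodicEnergy_triPoint]

/-- "… we obtain that `E_L^per(X_min, {y_min}) + 3L² ≤ 0`" (here: `E ≤ -6L²`, ordered form).
[cite: Theil2006, §3 Proof of Theorem 1.2 (preprint p. 14)] -/
theorem IsRelaxedMinimizer.energy_le (hV : IsNormalized V) (h : IsRelaxedMinimizer V L X y) :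
    relaxedPeriodicEnergy V L X y ≤ -6 * (L : ℝ) ^ 2 := by
  have := h.2.2 univ triPoint (isPeriodicSet_univ L) (isPeriodic_triPoint L)
  rwa [hV.relaxedPeriodicEnergy_univ_triPoint] at this

/-- The terms `e_*({x,x'}) + 1` of (44) are non-negative on short bonds (`V_* ≥ -1` by (1)).
[cite: Theil2006, §1 (1); §3 (44) (preprint p. 14)] -/
theorem IsNormalized.renormalizedPotential_add_one_nonneg (hV : IsNormalized V) (hα : α < 1)
    {k k' : ℤ × ℤ} (h : IsShortRange α y k k') :
    0 ≤ renormalizedPotential V (dist (y k) (y k')) + 1 := by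
  have hr : 0 < dist (y k) (y k') := by linarith [h.le_dist]
  linarith [hV.neg_one_le_renormalizedPotential hr]

/-- The short-bond sum of (44) is non-negative. [cite: Theil2006, §3 (44) (preprint p. 14)] -/
theorem IsNormalized.shortBondSum_nonneg (hV : IsNormalized V) (hα : α < 1) :
    0 ≤ shortBondSum α L X y (fun r => renormalizedPotential V r + 1) :=
  Finset.sum_nonneg fun _ _ => finsum_nonneg fun _ => finsum_nonneg fun hx' =>
    hV.renormalizedPotential_add_one_nonneg hα hx'.2

/-- **"Since `#X̃ ≤ L²` this estimate shows that `#X̃_min = L²`, `∂X̃_min = ∅`, and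
`|y_min(x) − y_min(x')| = 1` for all `{x,x'} ∈ 𝒮`"** — the three vanishing statements, for any
`L`-periodic pair `(X, y)` whose relaxed energy is `≤ -6L²` (`≤` the identity competitor) and
which satisfies (44) with some `C > 0`: every cell representative belongs to `X`, no defect
class, and every short bond from a representative has renormalized energy exactly `-1`.
[cite: Theil2006, §3 Proof of Theorem 1.2 (preprint p. 14)] -/
theorem vanishing_of_mainEstimate (hα : α < 1) (hV : IsNormalized V) (hL : 0 < L)
    (hy : IsPeriodic L y) (hE : relaxedPeriodicEnergy V L X y ≤ -6 * (L : ℝ) ^ 2) {C : ℝ}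
    (hC : 0 < C) (h44 : mainEstimateRHS C α V L X y ≤ relaxedPeriodicEnergy V L X y / 2) :
    cellClasses L X = Finset.univ ∧ defectClasses α L X y = ∅ ∧
      ∀ c : Fin L × Fin L, cellPoint c ∈ X → ∀ x' ∈ X, IsShortRange α y (cellPoint c) x' →
        renormalizedPotential V (dist (y (cellPoint c)) (y x')) = -1 := by
  set S := shortBondSum α L X y (fun r => renormalizedPotential V r + 1) with hS
  have hS0 : 0 ≤ S := hV.shortBondSum_nonneg hα
  have hD0 : (0 : ℝ) ≤ (defectClasses α L X y).card := Nat.cast_nonneg _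
  have hN : ((cellClasses L X).card : ℝ) ≤ (L : ℝ) ^ 2 := card_cellClasses_le
  have hCS : 0 ≤ 1 / C * (S / 2) := by positivity
  have h := h44
  unfold mainEstimateRHS at h
  rw [← hS] at h
  -- all three non-negative terms vanish
  have hS' : 1 / C * (S / 2) = 0 := by linarith
  have hSz : S = 0 := by
    rcases mul_eq_zero.1 hS' with h1 | h1
    · exfalso; have : (0 : ℝ) < 1 / C := by positivity
      linarith
    · linarith
  have hDz : ((defectClasses α L X y).card : ℝ) = 0 := by linarith
  have hNz : ((cellClasses L X).card : ℝ) = (L : ℝ) ^ 2 := by linarith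
  refine ⟨?_, ?_, ?_⟩
  · apply Finset.eq_univ_of_card
    have : (cellClasses L X).card = L * L := by
      have h' : ((cellClasses L X).card : ℝ) = ((L * L : ℕ) : ℝ) := by push_cast; rw [hNz]; ring
      exact_mod_cast h'
    rw [this, Fintype.card_prod, Fintype.card_fin]
  · rw [← Finset.card_eq_zero]
    exact_mod_cast hDz
  · intro c hc x' hx' hsr
    -- the inner finsum at `c` vanishes, and all its terms are `≥ 0`
    have hfin := hy.finite_shortRange hL X (cellPoint c) (α := α)
    have hcmem : c ∈ cellClasses L X := mem_cellClasses.2 hc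
    have hterm : ∀ c' ∈ cellClasses L X, 0 ≤ ∑ᶠ x' ∈ {x' | x' ∈ X ∧ IsShortRange α y (cellPoint c') x'},
        (renormalizedPotential V (dist (y (cellPoint c')) (y x')) + 1) := fun c' _ =>
      finsum_nonneg fun x' => finsum_nonneg fun hx' => hV.renormalizedPotential_add_one_nonneg hα hx'.2
    have hinner := (Finset.sum_eq_zero_iff_of_nonneg hterm).1 hSz c hcmem
    rw [finsum_mem_eq_finite_toFinset_sum _ hfin] at hinner
    have hx'mem : x' ∈ hfin.toFinset := by
      rw [Set.Finite.mem_toFinset]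
      exact ⟨hx', hsr⟩
    have := (Finset.sum_eq_zero_iff_of_nonneg fun x'' hx'' => ?_).1 hinner x' hx'mem
    · linarith
    · rw [Set.Finite.mem_toFinset] at hx''
      exact hV.renormalizedPotential_add_one_nonneg hα hx''.2

/-- **Structure of a relaxed minimizer under (44)** (p. 14): for `α` below a universal threshold,
`L ≥ 1`, `V` admissible and a minimizer `(X, y)` of the relaxed periodic energy satisfying (44)
(with any `C > 0`; (13) holds by Lemma 3.1): `X = A₂`, `y` has no defects, every short bond has
length exactly `1`, and (13) holds on all of `A₂`.
[cite: Theil2006, §3 Proof of Theorem 1.2 (preprint p. 14), with Lemma 3.1 (p. 13)] -/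
theorem exists_structure_of_isRelaxedMinimizer :
    ∃ α₀ : ℝ, 0 < α₀ ∧ α₀ < 1 / 3 ∧ ∀ α : ℝ, 0 < α → α < α₀ → ∀ L : ℕ, 0 < L →
      ∀ V : ℝ → ℝ, IsAdmissible α V → ∀ (X : Set (ℤ × ℤ)) (y : ℤ × ℤ → Plane),
        IsRelaxedMinimizer V L X y → ∀ C : ℝ, 0 < C →
          ((∀ x ∈ X, ∀ x' ∈ X, x ≠ x' → 1 - α < dist (y x) (y x')) →
              mainEstimateRHS C α V L X y ≤ relaxedPeriodicEnergy V L X y / 2) →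
            X = univ ∧ (∀ x, x ∉ defectSet α y) ∧
              (∀ x x', IsShortRange α y x x' → dist (y x) (y x') = 1) ∧
                ∀ x x', x ≠ x' → 1 - α < dist (y x) (y x') := by
  obtain ⟨α₁, hα₁, hα₁', h31⟩ := periodicMinimumDistance
  obtain ⟨α₂, hα₂, hone⟩ := exists_eq_one_of_renormalizedPotential_eq
  refine ⟨min (min α₁ α₂) (1 / 5), lt_min (lt_min hα₁ hα₂) (by norm_num),
    (min_le_right _ _).trans_lt (by norm_num), fun α hα hα' L hL V hV X y hmin C hC h44 => ?_⟩
  have hαα₁ : α < α₁ := hα'.trans_le ((min_le_left _ _).trans (min_le_left _ _))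
  have hαα₂ : α < α₂ := hα'.trans_le ((min_le_left _ _).trans (min_le_right _ _))
  have hα1 : α < 1 := hα'.trans_le ((min_le_right _ _).trans (by norm_num))
  obtain ⟨hX, hy, hmin'⟩ := hmin
  -- (13) on `X` by Lemma 3.1
  have h13 : ∀ x ∈ X, ∀ x' ∈ X, x ≠ x' → 1 - α < dist (y x) (y x') :=
    h31 α hα hαα₁ L hL V hV X y hX hy hmin'
  have hE := IsRelaxedMinimizer.energy_le hV.toIsNormalized ⟨hX, hy, hmin'⟩
  obtain ⟨hcells, hdef, hbond⟩ :=
    vanishing_of_mainEstimate hα1 hV.toIsNormalized hL hy hE hC (h44 h13)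
  have hXu : X = univ := hX.eq_univ_of_cellClasses_eq hL hcells
  subst hXu
  have h13' : ∀ x x', x ≠ x' → 1 - α < dist (y x) (y x') := fun x x' hne =>
    h13 x (mem_univ _) x' (mem_univ _) hne
  refine ⟨rfl, fun k hk => ?_, fun k k' hkk' => ?_, h13'⟩
  · -- no defects: transport the representative statement along `L A₂`
    obtain ⟨⟨c, g⟩, rfl⟩ := (cellEquiv hL).surjective k
    rw [cellEquiv_apply, mem_defectSet_iff, hy.ncard_nbhdSet_add_zsmul] at hk
    have hc : c ∈ defectClasses α L univ y := mem_defectClasses_univ.2 (mem_defectSet_iff.2 hk)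
    rw [hdef] at hc
    exact Finset.notMem_empty _ hc
  · -- unit bonds
    obtain ⟨⟨c, g⟩, rfl⟩ := (cellEquiv hL).surjective k
    rw [cellEquiv_apply] at hkk' ⊢
    have hsr : IsShortRange α y (cellPoint c) (k' - (L : ℤ) • g) := by
      rw [← hy.isShortRange_add_zsmul_iff (cellPoint c) (k' - (L : ℤ) • g) g]
      simpa using hkk'
    have hdist : dist (y (cellPoint c + (L : ℤ) • g)) (y k') =
        dist (y (cellPoint c)) (y (k' - (L : ℤ) • g)) := by
      rw [← hy.dist_add_zsmul (cellPoint c) (k' - (L : ℤ) • g) g]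
      simp
    rw [hdist]
    have hm1 := hbond c (mem_univ _) (k' - (L : ℤ) • g) (mem_univ _) hsr
    have hne : cellPoint c ≠ k' - (L : ℤ) • g := hsr.ne hα1
    exact hone α V hα hαα₂ hV _ (h13' _ _ hne) hsr.dist_le hm1

/-- **(42) and (43) for the image** `Ω = {y(x) | x ∈ A₂}` of a configuration on `A₂` which
satisfies (13), has no defects and all of whose short bonds have length `1`: "Hence, the set
`Ω = {y_min(x) | x ∈ A₂}` satisfies (42) and (43)". [cite: Theil2006, §3 Proof of Theorem 1.2 (preprint p. 14)] -/
theorem local_conditions_of_structure (hα : 0 < α) (hα1 : α < 1)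
    (h13 : ∀ x x', x ≠ x' → 1 - α < dist (y x) (y x'))
    (hdef : ∀ x, x ∉ defectSet α y) (hbond : ∀ x x', IsShortRange α y x x' → dist (y x) (y x') = 1) :
    (∀ x x', y x ≠ y x' → 1 ≤ dist (y x) (y x')) ∧
      ∀ x, {p ∈ Set.range y | dist (y x) p ≤ 1}.ncard = 7 := by
  have hshort : ∀ x x', x ≠ x' → dist (y x) (y x') ≤ 1 → IsShortRange α y x x' := by
    intro x x' hne hle
    unfold IsShortRange
    rw [abs_le]
    constructor <;> linarith [h13 x x' hne]
  have h42 : ∀ x x', y x ≠ y x' → 1 ≤ dist (y x) (y x') := by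
    intro x x' hne
    have hxx' : x ≠ x' := fun h => hne (by rw [h])
    by_contra hlt
    rw [not_le] at hlt
    have := hbond x x' (hshort x x' hxx' hlt.le)
    linarith
  refine ⟨h42, fun x => ?_⟩
  have hinj : Function.Injective y := fun a b hab => by
    by_contra hne
    have := h13 a b hne
    rw [hab, dist_self] at this
    linarith
  have hset : {p ∈ Set.range y | dist (y x) p ≤ 1} = y '' nbhdSet α y x := by
    ext p
    simp only [mem_setOf_eq, mem_range, mem_image, mem_nbhdSet_iff]
    constructor
    · rintro ⟨⟨x', rfl⟩, hd⟩
      by_cases hx : x' = x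
      · exact ⟨x', Or.inl hx, rfl⟩
      · exact ⟨x', Or.inr (hshort x x' (Ne.symm hx) hd), rfl⟩
    · rintro ⟨x', hx', rfl⟩
      refine ⟨⟨x', rfl⟩, ?_⟩
      rcases hx' with rfl | h
      · simp
      · exact (hbond x x' h).le
  rw [hset, Set.ncard_image_of_injective _ hinj]
  by_contra h7
  exact hdef x h7

/-- **Theil 2006, Theorem 1.2 — the end of its proof (§3, p. 14), from the periodic main estimate
(44).** There is a universal `α₀ ∈ (0, ⅓)` such that for `α ∈ (0, α₀)`, `L ≥ 1` and `V`
satisfying (1)–(5): IF (44) holds (with some `C > 0`) for all `L`-periodic `(X, y)` satisfying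
(13) ["We claim now that for configurations `X, y` which satisfy the bound (13) a suitably
adapted version of (9) holds: (44)"], and IF the relaxed periodic problem has a minimizer
["since there are only `2^{L²}` possible `L`-periodic sets `X`, a minimizer `(X_min, y_min)` of
`E_L^per` exists", p. 13], THEN for every ground state `y` of `E_L^per` over `Y_L^per` the set
`Ω = {y(x) | x ∈ A₂}` satisfies (42) and (43), and consequently `RΩ + τ = A₂` for a rotation `R`
(`det R = 1`) and a translation `τ` (`exists_rotation_range_eq_triangularLattice`). Chain: the
relaxed minimizer `(X₀, y₀)` has `X₀ = A₂` (`exists_structure_of_isRelaxedMinimizer`), so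
`E_L^per(y) ≤ E_L^per(y₀) = min E_L^per(·,·)` and `(A₂, y)` is itself a relaxed minimizer, to
which Lemma 3.1, (44) and the vanishing argument apply.
[cite: Theil2006, §3 Proof of Theorem 1.2 (preprint pp. 13–14)] -/
theorem exists_rotation_range_eq_of_mainEstimate :
    ∃ α₀ : ℝ, 0 < α₀ ∧ α₀ < 1 / 3 ∧ ∀ α : ℝ, 0 < α → α < α₀ → ∀ L : ℕ, 0 < L →
      ∀ V : ℝ → ℝ, IsAdmissible α V → ∀ C : ℝ, 0 < C →
        (∀ (X : Set (ℤ × ℤ)) (y : ℤ × ℤ → Plane), IsPeriodicSet L X → IsPeriodic L y →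
            (∀ x ∈ X, ∀ x' ∈ X, x ≠ x' → 1 - α < dist (y x) (y x')) →
              mainEstimateRHS C α V L X y ≤ relaxedPeriodicEnergy V L X y / 2) →
          (∃ (X₀ : Set (ℤ × ℤ)) (y₀ : ℤ × ℤ → Plane), IsRelaxedMinimizer V L X₀ y₀) →
            ∀ y : ℤ × ℤ → Plane, IsPeriodic L y →
              (∀ y' : ℤ × ℤ → Plane, IsPeriodic L y' → periodicEnergy V L y ≤ periodicEnergy V L y') →
                (∀ x x', y x ≠ y x' → 1 ≤ dist (y x) (y x')) ∧
                  (∀ x, {p ∈ Set.range y | dist (y x) p ≤ 1}.ncard = 7) ∧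
                    ∃ R : Plane ≃ₗᵢ[ℝ] Plane,
                      LinearMap.det (R.toLinearEquiv : Plane →ₗ[ℝ] Plane) = 1 ∧
                        ∃ τ : Plane, Set.range (fun k => R (y k) + τ) = triangularLattice := by
  obtain ⟨α₀, hα₀, hα₀', hstruct⟩ := exists_structure_of_isRelaxedMinimizer
  refine ⟨α₀, hα₀, hα₀', fun α hα hα' L hL V hV C hC h44 hex y hy hground => ?_⟩
  obtain ⟨X₀, y₀, hmin₀⟩ := hex
  -- the relaxed minimizer has `X₀ = A₂`
  obtain ⟨hX₀u, -, -, -⟩ := hstruct α hα hα' L hL V hV X₀ y₀ hmin₀ C hC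
    (h44 X₀ y₀ hmin₀.1 hmin₀.2.1)
  subst hX₀u
  -- hence `(A₂, y)` is a relaxed minimizer as well
  have hminy : IsRelaxedMinimizer V L univ y := by
    refine ⟨isPeriodicSet_univ L, hy, fun X' y' hX' hy' => ?_⟩
    calc relaxedPeriodicEnergy V L univ y = periodicEnergy V L y := relaxedPeriodicEnergy_univ V L y
      _ ≤ periodicEnergy V L y₀ := hground y₀ hmin₀.2.1
      _ = relaxedPeriodicEnergy V L univ y₀ := (relaxedPeriodicEnergy_univ V L y₀).symm
      _ ≤ relaxedPeriodicEnergy V L X' y' := hmin₀.2.2 X' y' hX' hy'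
  obtain ⟨-, hdef, hbond, h13⟩ := hstruct α hα hα' L hL V hV univ y hminy C hC
    (h44 univ y (isPeriodicSet_univ L) hy)
  obtain ⟨h42, h43⟩ := local_conditions_of_structure hα (hα'.trans (hα₀'.trans (by norm_num))) h13 hdef hbond
  obtain ⟨-, R, hR, τ, hτ⟩ := exists_rotation_range_eq_triangularLattice h42 h43
  exact ⟨h42, h43, R, hR, τ, hτ⟩

end EndOfProof

/-! ### Consistency check: (44) is an equality on the undeformed lattice -/

section PerfectLattice

variable {α : ℝ} {V : ℝ → ℝ}

/-- The undeformed lattice has no defect classes (`0 ≤ α < √3 − 1`).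
[cite: Theil2006, §2.1 (∂X(y), preprint p. 4) and §3 (preprint p. 13); instance y = id] -/
theorem defectClasses_univ_triPoint (hα0 : 0 ≤ α) (hα : α < √3 - 1) (L : ℕ) :
    defectClasses α L univ triPoint = ∅ := by
  ext c
  simp [mem_defectClasses_univ, defectSet_triPoint_eq_empty hα0 hα]

/-- On the undeformed lattice every short bond has length `1`, so `∑_{𝒮̃} (e_* + 1) = 0`.
[cite: Theil2006, §3 (44) (preprint p. 14); instance y = id] -/
theorem shortBondSum_univ_triPoint (hα0 : 0 ≤ α) (hα : α < √3 - 1) (hV : IsNormalized V)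
    (L : ℕ) : shortBondSum α L univ triPoint (fun r => renormalizedPotential V r + 1) = 0 := by
  unfold shortBondSum
  refine Finset.sum_eq_zero fun c _ => finsum_mem_of_eqOn_zero fun x' hx' => ?_
  have h := (isShortRange_triPoint_iff hα0 hα).1 hx'.2
  simp only [Pi.zero_apply]
  rw [dist_comm, dist_triPoint, norm_triPoint_of_mem_unitShell h, hV.renormalizedPotential_one]
  ring

/-- **(44) holds with equality on the undeformed lattice**: both sides equal `−3L²` in the
printed normalisation (`E_L^per(A₂, id)/2 = −3L²`; no defects, all bonds of length `1`, `L²`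
classes) — a check that the constants and normalisations of `mainEstimateRHS` are the printed
ones. [cite: Theil2006, §3 (44) and «E_L^per(X_min,{y_min}) + 3L² ≤ 0» (preprint p. 14); instance y = id] -/
theorem mainEstimateRHS_univ_triPoint (hα0 : 0 ≤ α) (hα : α < √3 - 1) (hV : IsNormalized V)
    (L : ℕ) (C : ℝ) :
    mainEstimateRHS C α V L univ triPoint = -3 * (L : ℝ) ^ 2 ∧
      relaxedPeriodicEnergy V L univ triPoint / 2 = -3 * (L : ℝ) ^ 2 := by
  constructor
  · rw [mainEstimateRHS, shortBondSum_univ_triPoint hα0 hα hV, defectClasses_univ_triPoint hα0 hα,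
      cellClasses_univ]
    simp [Finset.card_univ, Fintype.card_prod, Fintype.card_fin]
    ring
  · rw [hV.relaxedPeriodicEnergy_univ_triPoint]
    ring

end PerfectLattice

/-! ### Existence of a minimizer of the relaxed periodic problem (p. 13) for continuous `V` -/

section Existence

variable {α : ℝ} {V : ℝ → ℝ} {L : ℕ} {X : Set (ℤ × ℤ)} {y : ℤ × ℤ → Plane}

/-- `triPoint (L g) = L · triPoint g` (local copy of a private lemma of
`Theil2006PeriodicMinimumDistance.lean`). [folklore] -/
private theorem triPoint_zsmul' (L : ℕ) (g : ℤ × ℤ) :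
    triPoint ((L : ℤ) • g) = (L : ℝ) • triPoint g := by
  rw [map_zsmul, ← Int.cast_smul_eq_zsmul ℝ, Int.cast_natCast]

/-- **Cell data ↦ periodic configuration.** The `L A₂`-periodic extension of positions
`u : A₂ ∩ LU → ℝ²` prescribed on the period cell: `y(x + L g) = u(x) + L ξ_g`; every `y ∈ Y_L^per`
arises this way (`IsPeriodic.periodicExtend_eq`), so `Y_L^per ≅ (ℝ²)^{L²}`.
[cite: Theil2006, §1 Theorem 1.2 (`Y_L^per`, preprint p. 3); our parametrisation] -/
def periodicExtend (hL : 0 < L) (u : Fin L × Fin L → Plane) (k : ℤ × ℤ) : Plane :=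
  u ((cellEquiv hL).symm k).1 + (L : ℝ) • triPoint ((cellEquiv hL).symm k).2

/-- `periodicExtend u (x + L g) = u(x) + L ξ_g`. [cite: Theil2006, §1 Theorem 1.2 (`Y_L^per`, preprint p. 3); our parametrisation] -/
theorem periodicExtend_apply (hL : 0 < L) (u : Fin L × Fin L → Plane) (c : Fin L × Fin L)
    (g : ℤ × ℤ) : periodicExtend hL u (cellPoint c + (L : ℤ) • g) = u c + (L : ℝ) • triPoint g := by
  simp only [periodicExtend, cellEquiv_symm_cellPoint_add]

/-- On the period cell `periodicExtend u` is `u`. [cite: Theil2006, §1 Theorem 1.2 (`Y_L^per`, preprint p. 3); our parametrisation] -/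
theorem periodicExtend_cellPoint (hL : 0 < L) (u : Fin L × Fin L → Plane) (c : Fin L × Fin L) :
    periodicExtend hL u (cellPoint c) = u c := by
  have h := periodicExtend_apply hL u c 0
  simpa using h

/-- `periodicExtend u ∈ Y_L^per`. [cite: Theil2006, §1 Theorem 1.2 (`Y_L^per`, preprint p. 3); our parametrisation] -/
theorem isPeriodic_periodicExtend (hL : 0 < L) (u : Fin L × Fin L → Plane) :
    IsPeriodic L (periodicExtend hL u) := by
  intro k g
  obtain ⟨⟨c, g'⟩, rfl⟩ := (cellEquiv hL).surjective k
  rw [cellEquiv_apply, show cellPoint c + (L : ℤ) • g' + (L : ℤ) • g =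
      cellPoint c + (L : ℤ) • (g' + g) by rw [smul_add]; abel,
    periodicExtend_apply, periodicExtend_apply, triPoint_zsmul', map_add, smul_add]
  abel

/-- Every `y ∈ Y_L^per` is the periodic extension of its cell data.
[cite: Theil2006, §1 Theorem 1.2 (`Y_L^per`, preprint p. 3); our parametrisation] -/
theorem IsPeriodic.periodicExtend_eq (hL : 0 < L) (hy : IsPeriodic L y) :
    periodicExtend hL (fun c => y (cellPoint c)) = y := by
  funext k
  obtain ⟨⟨c, g⟩, rfl⟩ := (cellEquiv hL).surjective k
  rw [cellEquiv_apply, periodicExtend_apply, hy.apply_add_zsmul]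

/-- The row of particle `x` in `E_L^per(X, {y})`: `∑_{x' ∈ X ∖ {x}} V(|y(x) − y(x')|)`, so that
`E_L^per(X, {y}) = ∑_{x ∈ X ∩ LU} row(x)` (`relaxedPeriodicEnergy_eq_sum_rowEnergy`).
[cite: Theil2006, §3 (`E_L^per(X, {y})`, preprint p. 13)] -/
def rowEnergy (V : ℝ → ℝ) (X : Set (ℤ × ℤ)) (y : ℤ × ℤ → Plane) (k : ℤ × ℤ) : ℝ :=
  ∑' k' : {k' : ℤ × ℤ // k' ∈ X ∧ k' ≠ k}, V (dist (y k) (y k'.1))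

/-- `E_L^per(X, {y})` as the sum of the rows of the cell representatives in `X`.
[cite: Theil2006, §3 (`E_L^per(X, {y})`, preprint p. 13)] -/
theorem relaxedPeriodicEnergy_eq_sum_rowEnergy (V : ℝ → ℝ) (L : ℕ) (X : Set (ℤ × ℤ))
    (y : ℤ × ℤ → Plane) :
    relaxedPeriodicEnergy V L X y = ∑ c : Fin L × Fin L, X.indicator (rowEnergy V X y) (cellPoint c) :=
  rfl

/-- Relabelling the particles by a bijection of `A₂` preserving `X` moves rows to rows.
[cite: Theil2006, §3 (preprint p. 13); our lemma] -/
theorem rowEnergy_comp_equiv (ψ : ℤ × ℤ ≃ ℤ × ℤ) (hψ : ∀ k, ψ k ∈ X ↔ k ∈ X) (k : ℤ × ℤ) :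
    rowEnergy V X (y ∘ ψ) k = rowEnergy V X y (ψ k) := by
  unfold rowEnergy
  let e' : {k' : ℤ × ℤ // k' ∈ X ∧ k' ≠ k} ≃ {k' : ℤ × ℤ // k' ∈ X ∧ k' ≠ ψ k} :=
    ψ.subtypeEquiv fun k' => by rw [hψ, ψ.injective.ne_iff]
  rw [← e'.tsum_eq]
  rfl

/-- Rows are `L A₂`-periodic: `row(x + Lg) = row(x)` for periodic `X` and `y`.
[cite: Theil2006, §3 (preprint p. 13); our lemma] -/
theorem IsPeriodic.rowEnergy_add_zsmul (hX : IsPeriodicSet L X) (hy : IsPeriodic L y) (k g : ℤ × ℤ) :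
    rowEnergy V X y (k + (L : ℤ) • g) = rowEnergy V X y k := by
  have hψ : ∀ k', Equiv.addRight ((L : ℤ) • g) k' ∈ X ↔ k' ∈ X := fun k' =>
    hX.add_zsmul_mem_iff k' g
  rw [show k + (L : ℤ) • g = Equiv.addRight ((L : ℤ) • g) k from rfl, ← rowEnergy_comp_equiv _ hψ]
  unfold rowEnergy
  refine tsum_congr fun k' => ?_
  simp only [Function.comp_apply, Equiv.coe_addRight, hy.dist_add_zsmul]

/-- **Classwise period shifts of the cell data are relabellings.** The bijection of `A₂` that
translates the class of `x ∈ A₂ ∩ LU` by `L G(x) ∈ L A₂`: `x + Lg ↦ x + L(g + G(x))`.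
[cite: Theil2006, §3 (preprint p. 13); our lemma] -/
def classShift (hL : 0 < L) (G : Fin L × Fin L → ℤ × ℤ) : ℤ × ℤ ≃ ℤ × ℤ :=
  ((cellEquiv hL).symm.trans
    (Equiv.prodShear (Equiv.refl _) fun c => Equiv.addRight (G c))).trans (cellEquiv hL)

/-- `classShift G (x + Lg) = x + L(g + G(x))`. [cite: Theil2006, §3 (preprint p. 13); our lemma] -/
theorem classShift_apply (hL : 0 < L) (G : Fin L × Fin L → ℤ × ℤ) (c : Fin L × Fin L)
    (g : ℤ × ℤ) : classShift hL G (cellPoint c + (L : ℤ) • g) = cellPoint c + (L : ℤ) • (g + G c) := by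
  simp only [classShift, Equiv.trans_apply, cellEquiv_symm_cellPoint_add, Equiv.prodShear_apply,
    Equiv.refl_apply, Equiv.coe_addRight, cellEquiv_apply]

/-- A classwise shift preserves every `L`-periodic set. [cite: Theil2006, §3 (preprint p. 13); our lemma] -/
theorem classShift_mem_iff (hL : 0 < L) (hX : IsPeriodicSet L X) (G : Fin L × Fin L → ℤ × ℤ)
    (k : ℤ × ℤ) : classShift hL G k ∈ X ↔ k ∈ X := by
  obtain ⟨⟨c, g⟩, rfl⟩ := (cellEquiv hL).surjective k
  rw [cellEquiv_apply, classShift_apply, hX.add_zsmul_mem_iff, hX.add_zsmul_mem_iff]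

/-- Shifting the cell data classwise by period vectors = relabelling the periodic extension.
[cite: Theil2006, §3 (preprint p. 13); our lemma] -/
theorem periodicExtend_shift (hL : 0 < L) (u : Fin L × Fin L → Plane)
    (G : Fin L × Fin L → ℤ × ℤ) :
    periodicExtend hL (fun c => u c + (L : ℝ) • triPoint (G c)) =
      periodicExtend hL u ∘ classShift hL G := by
  funext k
  obtain ⟨⟨c, g⟩, rfl⟩ := (cellEquiv hL).surjective k
  rw [Function.comp_apply, cellEquiv_apply, classShift_apply, periodicExtend_apply,
    periodicExtend_apply, map_add, smul_add]
  abel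

/-- **The relaxed energy is invariant under classwise period shifts of the cell data** (so it
descends to the compact torus `(ℝ² / L A₂)^{X̃}`; this is the compactness behind "a minimizer
`(X_min, y_min)` of `E_L^per` exists", p. 13). [cite: Theil2006, §3 (preprint p. 13); our lemma] -/
theorem relaxedPeriodicEnergy_shift (hL : 0 < L) (hX : IsPeriodicSet L X)
    (u : Fin L × Fin L → Plane) (G : Fin L × Fin L → ℤ × ℤ) :
    relaxedPeriodicEnergy V L X (periodicExtend hL fun c => u c + (L : ℝ) • triPoint (G c)) =
      relaxedPeriodicEnergy V L X (periodicExtend hL u) := by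
  rw [periodicExtend_shift, relaxedPeriodicEnergy_eq_sum_rowEnergy, relaxedPeriodicEnergy_eq_sum_rowEnergy]
  refine Finset.sum_congr rfl fun c _ => ?_
  by_cases hc : cellPoint c ∈ X
  · rw [indicator_of_mem hc, indicator_of_mem hc, rowEnergy_comp_equiv _ (classShift_mem_iff hL hX G),
      show classShift hL G (cellPoint c) = cellPoint c + (L : ℤ) • G c by
        simpa using classShift_apply hL G c 0,
      (isPeriodic_periodicExtend hL u).rowEnergy_add_zsmul hX]
  · rw [indicator_of_notMem hc, indicator_of_notMem hc]

/-- **A compact fundamental domain.** Every point of `ℝ²` has an `L A₂`-translate of norm `≤ 2L`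
(reduce the coordinates along `b₂` and then `b₁` modulo `L`): the identification of `A₂ mod LA₂`
with the period cell, for positions in `ℝ²`.
[cite: Theil2006, §1 («we identify … A₂ mod LA₂ with the representatives A₂ ∩ LU», preprint p. 2); our lemma] -/
theorem exists_norm_add_smul_triPoint_le (hL : 0 < L) (p : Plane) :
    ∃ g : ℤ × ℤ, ‖p + (L : ℝ) • triPoint g‖ ≤ 2 * L := by
  have hL' : (0 : ℝ) < L := by exact_mod_cast hL
  have h3 : (0 : ℝ) < √3 := Real.sqrt_pos.2 (by norm_num)
  have h3' : (√3 : ℝ) ^ 2 = 3 := Real.sq_sqrt (by norm_num)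
  -- second coordinate: `p 1 = (√3/2) b`
  set b : ℝ := 2 * p 1 / √3 with hb
  set n : ℤ := ⌊b / L⌋ with hn
  -- first coordinate after the `b₂`-reduction
  set a : ℝ := p 0 - L * n / 2 with ha
  set m : ℤ := ⌊a / L⌋ with hm
  refine ⟨(-m, -n), ?_⟩
  set q : Plane := p + (L : ℝ) • triPoint (-m, -n) with hq
  have hq0 : q 0 = a - L * m := by
    simp only [hq, ha, PiLp.add_apply, PiLp.smul_apply, triPoint_apply_zero, smul_eq_mul,
      Int.cast_neg]
    ring
  have hq1 : q 1 = √3 / 2 * (b - L * n) := by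
    simp only [hq, hb, PiLp.add_apply, PiLp.smul_apply, triPoint_apply_one, smul_eq_mul,
      Int.cast_neg]
    field_simp
    ring
  have ha0 : 0 ≤ a - L * m := by
    have := Int.sub_floor_div_mul_nonneg a hL'
    rw [hm]; linarith [mul_comm (L : ℝ) (⌊a / L⌋ : ℝ)]
  have ha1 : a - L * m ≤ L := by
    have := Int.sub_floor_div_mul_lt a hL'
    rw [hm]; linarith [mul_comm (L : ℝ) (⌊a / L⌋ : ℝ)]
  have hb0 : 0 ≤ b - L * n := by
    have := Int.sub_floor_div_mul_nonneg b hL'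
    rw [hn]; linarith [mul_comm (L : ℝ) (⌊b / L⌋ : ℝ)]
  have hb1 : b - L * n ≤ L := by
    have := Int.sub_floor_div_mul_lt b hL'
    rw [hn]; linarith [mul_comm (L : ℝ) (⌊b / L⌋ : ℝ)]
  have hq0' : 0 ≤ q 0 ∧ q 0 ≤ L := by rw [hq0]; exact ⟨ha0, ha1⟩
  have hq1' : 0 ≤ q 1 ∧ q 1 ≤ L := by
    rw [hq1]
    constructor
    · positivity
    · have : √3 / 2 ≤ 1 := by nlinarith
      calc √3 / 2 * (b - L * n) ≤ 1 * (b - L * n) :=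
            mul_le_mul_of_nonneg_right this hb0
        _ ≤ L := by linarith
  have hsq : ‖q‖ ^ 2 = q 0 ^ 2 + q 1 ^ 2 := by
    rw [EuclideanSpace.norm_sq_eq, Fin.sum_univ_two, Real.norm_eq_abs, Real.norm_eq_abs, sq_abs,
      sq_abs]
  have hle : ‖q‖ ^ 2 ≤ (2 * L) ^ 2 := by
    rw [hsq]; nlinarith [hq0'.1, hq0'.2, hq1'.1, hq1'.2]
  exact (pow_le_pow_iff_left₀ (norm_nonneg q) (by positivity) two_ne_zero).1 hle

/-- Summability over a product with a finite first factor, slice by slice (local copy of a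
private lemma of `Theil2006PeriodicMinimumDistance.lean`). [folklore] -/
private theorem summable_prod_of_finite_fst' {ι β : Type*} [Fintype ι] [DecidableEq ι]
    {f : ι × β → ℝ} (hf : ∀ i, Summable fun b => f (i, b)) : Summable f := by
  have hpiece : ∀ i, Summable fun q : ι × β => if q.1 = i then f q else 0 := by
    intro i
    have hinj : Function.Injective fun b : β => (i, b) := Prod.mk_right_injective i
    have h0 : ∀ q ∉ Set.range (fun b : β => (i, b)), (if q.1 = i then f q else 0) = 0 := by
      rintro ⟨i', b⟩ hq
      rw [if_neg]
      rintro rfl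
      exact hq ⟨b, rfl⟩
    refine (hinj.summable_iff h0).1 ?_
    simpa [Function.comp_def] using hf i
  have hsum := summable_sum (s := Finset.univ) fun i _ => hpiece i
  refine hsum.congr fun q => ?_
  simp only [Finset.sum_ite_eq, Finset.mem_univ, if_true]

/-- **The rows of `E_L^per(X, {y})` depend continuously on the cell data** when `V` is, in
addition to (1)–(5), continuous on `[0, ∞)`: on every ball of cell data the row is a uniformly
dominated series (near terms by `max |V|` on a compact interval, far terms by the decay (12)
`|V(r)| ≤ α r⁻⁵` against the lattice `p`-series). [cite: Theil2006, §3 («a minimizer (X_min, y_min) of E_L^per exists», preprint p. 13); our lemma] -/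
theorem continuous_rowEnergy_periodicExtend (hV : IsAdmissible α V) (hVc : ContinuousOn V (Ici 0))
    (hL : 0 < L) (X : Set (ℤ × ℤ)) (c : Fin L × Fin L) :
    Continuous fun u : Fin L × Fin L → Plane => rowEnergy V X (periodicExtend hL u) (cellPoint c) := by
  classical
  have hL1 : (1 : ℝ) ≤ L := by exact_mod_cast hL
  have hα := hV.alpha_nonneg
  rw [continuous_iff_continuousAt]
  intro u₀
  obtain ⟨n, hn⟩ := exists_nat_gt ‖u₀‖
  suffices h : ContinuousOn (fun u : Fin L × Fin L → Plane => rowEnergy V X (periodicExtend hL u) (cellPoint c))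
      (Metric.closedBall 0 n) from
    (h.mono Metric.ball_subset_closedBall).continuousAt
      (Metric.isOpen_ball.mem_nhds (by simpa using hn))
  -- constants of the domination
  set T : ℝ := 2 * n + 4 / 3 with hT
  set Rad : ℝ := 2 * n + L * T with hRad
  obtain ⟨M, hM⟩ := (isCompact_Icc : IsCompact (Icc (0 : ℝ) Rad)).exists_bound_of_continuousOn
    (hVc.mono Icc_subset_Ici_self)
  -- the dominating family, on labels and along the cell decomposition
  set b : ℤ × ℤ → ℝ := fun g =>
    if ‖triPoint g‖ ≤ T then max M 0 else α * ((L : ℝ) * ‖triPoint g‖ - 2 * n)⁻¹ ^ 5 with hb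
  set bnd : ℤ × ℤ → ℝ := fun k' => b ((cellEquiv hL).symm k').2 with hbnd
  have hb_nonneg : ∀ g, 0 ≤ b g := fun g => by
    simp only [hb]
    split_ifs with h
    · exact le_max_right _ _
    · have : 0 ≤ (L : ℝ) * ‖triPoint g‖ - 2 * n := by nlinarith [norm_nonneg (triPoint g)]
      positivity
  -- summability of `b` over `A₂`
  have hb_summ : Summable b := by
    refine Summable.of_norm_bounded_eventually
      ((summable_norm_triPoint_inv_pow).mul_left (32 * α)) ?_
    filter_upwards [tendsto_norm_triPoint_cofinite.eventually_ge_atTop (max T (4 * n) + 1)]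
      with g hg
    have hgT : ¬ ‖triPoint g‖ ≤ T := by
      have := le_max_left T (4 * n); rw [not_le]; linarith
    have hg4 : 4 * (n : ℝ) ≤ ‖triPoint g‖ := by linarith [le_max_right T (4 * n)]
    rw [Real.norm_eq_abs, abs_of_nonneg (hb_nonneg g)]
    simp only [hb, if_neg hgT]
    have hpos : 0 < ‖triPoint g‖ := by linarith [le_max_left T (4 * n)]
    have hden : ‖triPoint g‖ / 2 ≤ (L : ℝ) * ‖triPoint g‖ - 2 * n := by nlinarith
    have h1 : ((L : ℝ) * ‖triPoint g‖ - 2 * n)⁻¹ ≤ (‖triPoint g‖ / 2)⁻¹ :=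
      inv_anti₀ (by positivity) hden
    have h2 : ((L : ℝ) * ‖triPoint g‖ - 2 * n)⁻¹ ^ 5 ≤ (‖triPoint g‖ / 2)⁻¹ ^ 5 :=
      pow_le_pow_left₀ (le_of_lt (inv_pos.2 (by linarith))) h1 5
    have h3 : (‖triPoint g‖ / 2)⁻¹ ^ 5 = 32 * ‖triPoint g‖⁻¹ ^ 5 := by
      rw [inv_div, div_pow, inv_pow]; ring
    calc α * ((L : ℝ) * ‖triPoint g‖ - 2 * n)⁻¹ ^ 5 ≤ α * (32 * ‖triPoint g‖⁻¹ ^ 5) := by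
          rw [← h3]; exact mul_le_mul_of_nonneg_left h2 hα
      _ = 32 * α * ‖triPoint g‖⁻¹ ^ 5 := by ring
  have hbnd_summ : Summable bnd := by
    rw [← (cellEquiv hL).summable_iff]
    refine summable_prod_of_finite_fst' fun c' => ?_
    have e : ∀ g, (bnd ∘ cellEquiv hL) (c', g) = b g := fun g => by
      simp only [hbnd, Function.comp_apply, Equiv.symm_apply_apply]
    simp_rw [e]
    exact hb_summ
  -- apply the dominated-continuity criterion
  unfold rowEnergy
  refine continuousOn_tsum (u := fun k' : {k' : ℤ × ℤ // k' ∈ X ∧ k' ≠ cellPoint c} => bnd k'.1)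
    (fun k' => ?_) (hbnd_summ.subtype _) (fun k' u hu => ?_)
  · -- each term is continuous in the cell data
    have hd : Continuous fun u : Fin L × Fin L → Plane =>
        dist (periodicExtend hL u (cellPoint c)) (periodicExtend hL u k'.1) := by
      unfold periodicExtend
      fun_prop
    exact (hVc.comp_continuous hd fun u => dist_nonneg).continuousOn
  · -- the domination on the ball `‖u‖ ≤ n`
    obtain ⟨⟨c', g'⟩, hk'⟩ := (cellEquiv hL).surjective k'.1
    have hun : ‖u‖ ≤ n := by simpa using hu
    have huc : ‖u c‖ ≤ n := (norm_le_pi_norm u c).trans hun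
    have huc' : ‖u c'‖ ≤ n := (norm_le_pi_norm u c').trans hun
    have hyk : periodicExtend hL u k'.1 = u c' + (L : ℝ) • triPoint g' := by
      rw [← hk', cellEquiv_apply, periodicExtend_apply]
    have hbk : bnd k'.1 = b g' := by
      simp only [hbnd, ← hk', Equiv.symm_apply_apply]
    rw [periodicExtend_cellPoint, hyk, hbk, Real.norm_eq_abs]
    set d : ℝ := dist (u c) (u c' + (L : ℝ) • triPoint g') with hd
    have hLξ : ‖(L : ℝ) • triPoint g'‖ = L * ‖triPoint g'‖ := by
      rw [norm_smul, Real.norm_natCast]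
    have hd_le : d ≤ 2 * n + L * ‖triPoint g'‖ := by
      rw [hd, dist_eq_norm]
      calc ‖u c - (u c' + (L : ℝ) • triPoint g')‖ = ‖u c - u c' - (L : ℝ) • triPoint g'‖ := by
            congr 1; abel
        _ ≤ ‖u c - u c'‖ + ‖(L : ℝ) • triPoint g'‖ := norm_sub_le _ _
        _ ≤ ‖u c‖ + ‖u c'‖ + ‖(L : ℝ) • triPoint g'‖ := by linarith [norm_sub_le (u c) (u c')]
        _ ≤ 2 * n + L * ‖triPoint g'‖ := by rw [hLξ]; linarith
    have hd_ge : L * ‖triPoint g'‖ - 2 * n ≤ d := by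
      rw [hd, dist_eq_norm]
      have h1 : ‖(L : ℝ) • triPoint g'‖ - ‖u c - u c'‖ ≤ ‖u c - u c' - (L : ℝ) • triPoint g'‖ := by
        have := norm_sub_norm_le ((L : ℝ) • triPoint g') (u c - u c')
        rw [← norm_neg (u c - u c' - (L : ℝ) • triPoint g')]
        have e : -(u c - u c' - (L : ℝ) • triPoint g') = (L : ℝ) • triPoint g' - (u c - u c') := by
          abel
        rw [e]; linarith [abs_norm_sub_norm_le ((L : ℝ) • triPoint g') (u c - u c'),
          le_abs_self (‖(L : ℝ) • triPoint g'‖ - ‖u c - u c'‖)]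
      have e2 : u c - (u c' + (L : ℝ) • triPoint g') = u c - u c' - (L : ℝ) • triPoint g' := by abel
      rw [e2]
      linarith [norm_sub_le (u c) (u c'), hLξ.symm.le, hLξ.le]
    have hd0 : 0 ≤ d := dist_nonneg
    simp only [hb]
    split_ifs with hcase
    · -- near: `d ≤ Rad`, `|V d| ≤ M`
      have hdR : d ∈ Icc (0 : ℝ) Rad := ⟨hd0, by rw [hRad]; nlinarith⟩
      exact (hM d hdR).trans (le_max_left _ _)
    · -- far: `d ≥ L|ξ| - 2n > 4/3`, decay (12)
      rw [not_le] at hcase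
      have hLξ' : ‖triPoint g'‖ ≤ L * ‖triPoint g'‖ := by nlinarith [norm_nonneg (triPoint g')]
      have hd43 : 4 / 3 ≤ d := by rw [hT] at hcase; linarith
      have hpos : 0 < L * ‖triPoint g'‖ - 2 * n := by rw [hT] at hcase; linarith
      refine (hV.abs_apply_le' hd43).trans ?_
      have h1 : d⁻¹ ≤ (L * ‖triPoint g'‖ - 2 * n)⁻¹ := inv_anti₀ hpos hd_ge
      have h2 : d⁻¹ ^ 5 ≤ (L * ‖triPoint g'‖ - 2 * n)⁻¹ ^ 5 :=
        pow_le_pow_left₀ (inv_nonneg.2 hd0) h1 5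
      exact mul_le_mul_of_nonneg_left h2 hα

/-- `E_L^per(X, {·})` is continuous in the cell data (continuous admissible `V`).
[cite: Theil2006, §3 («a minimizer (X_min, y_min) of E_L^per exists», preprint p. 13); our lemma] -/
theorem continuous_relaxedPeriodicEnergy_periodicExtend (hV : IsAdmissible α V)
    (hVc : ContinuousOn V (Ici 0)) (hL : 0 < L) (X : Set (ℤ × ℤ)) :
    Continuous fun u : Fin L × Fin L → Plane => relaxedPeriodicEnergy V L X (periodicExtend hL u) := by
  simp only [relaxedPeriodicEnergy_eq_sum_rowEnergy]
  refine continuous_finsetSum _ fun c _ => ?_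
  by_cases hc : cellPoint c ∈ X
  · simp only [indicator_of_mem hc]
    exact continuous_rowEnergy_periodicExtend hV hVc hL X c
  · simp only [indicator_of_notMem hc]
    exact continuous_const

/-- **Minimizers for a fixed periodic set `X`**: for continuous admissible `V`, `E_L^per(X, {·})`
attains its infimum over `Y_L^per` (continuity on the compact fundamental domain
`{‖u(x)‖ ≤ 2L}^{A₂ ∩ LU}` of the classwise period shifts).
[cite: Theil2006, §3 («a minimizer (X_min, y_min) of E_L^per exists», preprint p. 13); our lemma] -/
theorem exists_isMinOn_relaxedPeriodicEnergy (hV : IsAdmissible α V) (hVc : ContinuousOn V (Ici 0))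
    (hL : 0 < L) (hX : IsPeriodicSet L X) :
    ∃ u₀ : Fin L × Fin L → Plane, ∀ u : Fin L × Fin L → Plane,
      relaxedPeriodicEnergy V L X (periodicExtend hL u₀) ≤
        relaxedPeriodicEnergy V L X (periodicExtend hL u) := by
  set K : Set (Fin L × Fin L → Plane) := Set.pi univ fun _ => Metric.closedBall (0 : Plane) (2 * L)
    with hK
  have hKc : IsCompact K := isCompact_univ_pi fun _ => isCompact_closedBall _ _
  have hKne : K.Nonempty := ⟨0, fun c _ => by simp [Metric.mem_closedBall]⟩
  obtain ⟨u₀, -, hmin⟩ := hKc.exists_isMinOn hKne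
    (continuous_relaxedPeriodicEnergy_periodicExtend hV hVc hL X).continuousOn
  refine ⟨u₀, fun u => ?_⟩
  choose G hG using fun c => exists_norm_add_smul_triPoint_le hL (u c)
  have hu' : (fun c => u c + (L : ℝ) • triPoint (G c)) ∈ K := fun c _ => by
    simpa [Metric.mem_closedBall, dist_zero_right] using hG c
  calc relaxedPeriodicEnergy V L X (periodicExtend hL u₀)
      ≤ relaxedPeriodicEnergy V L X (periodicExtend hL fun c => u c + (L : ℝ) • triPoint (G c)) :=
        hmin hu'
    _ = relaxedPeriodicEnergy V L X (periodicExtend hL u) := relaxedPeriodicEnergy_shift hL hX u G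

/-- The `L`-periodic set with a prescribed set of classes `S ⊂ A₂ ∩ LU` ("there are only
`2^{L²}` possible `L`-periodic sets `X`", p. 13). [cite: Theil2006, §3 (preprint p. 13)] -/
def setOfClasses (hL : 0 < L) (S : Finset (Fin L × Fin L)) : Set (ℤ × ℤ) :=
  {k | ((cellEquiv hL).symm k).1 ∈ S}

/-- `setOfClasses S` is `L`-periodic. [cite: Theil2006, §3 (preprint p. 13)] -/
theorem isPeriodicSet_setOfClasses (hL : 0 < L) (S : Finset (Fin L × Fin L)) :
    IsPeriodicSet L (setOfClasses hL S) := by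
  intro k hk g
  obtain ⟨⟨c, g'⟩, rfl⟩ := (cellEquiv hL).surjective k
  simp only [setOfClasses, mem_setOf_eq, cellEquiv_apply, cellEquiv_symm_cellPoint_add] at hk ⊢
  rw [show cellPoint c + (L : ℤ) • g' + (L : ℤ) • g = cellPoint c + (L : ℤ) • (g' + g) by
    rw [smul_add]; abel, cellEquiv_symm_cellPoint_add]
  exact hk

/-- Every `L`-periodic set is `setOfClasses` of its classes (`2^{L²}` periodic sets in all).
[cite: Theil2006, §3 (preprint p. 13)] -/
theorem IsPeriodicSet.eq_setOfClasses (hL : 0 < L) (hX : IsPeriodicSet L X) :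
    X = setOfClasses hL (cellClasses L X) := by
  ext k
  rw [setOfClasses, mem_setOf_eq, mem_cellClasses, ← hX.mem_iff_cellPoint_mem hL]

/-- **Existence of a minimizer of the relaxed periodic problem** ("since there are only
`2^{L²}` possible `L`-periodic sets `X`, a minimizer `(X_min, y_min)` of `E_L^per` exists",
p. 13), PROVED for admissible potentials that are moreover continuous on `[0, ∞)`: minimize
`E_L^per(X, {·})` over the compact torus of cell data for each of the finitely many `X`
(`exists_isMinOn_relaxedPeriodicEnergy`), then over `X`. (For the real-valued potentials of
`Theil2006.lean`, which (2)–(3) allow to be discontinuous at `1 − α`, the energy need not be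
lower semicontinuous and the printed assertion is kept as a hypothesis elsewhere in this file.)
[cite: Theil2006, §3 («a minimizer (X_min, y_min) of E_L^per exists», preprint p. 13)] -/
theorem exists_isRelaxedMinimizer (hV : IsAdmissible α V) (hVc : ContinuousOn V (Ici 0))
    (hL : 0 < L) : ∃ (X : Set (ℤ × ℤ)) (y : ℤ × ℤ → Plane), IsRelaxedMinimizer V L X y := by
  classical
  have hmin : ∀ S : Finset (Fin L × Fin L), ∃ u₀ : Fin L × Fin L → Plane,
      ∀ u : Fin L × Fin L → Plane,
        relaxedPeriodicEnergy V L (setOfClasses hL S) (periodicExtend hL u₀) ≤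
          relaxedPeriodicEnergy V L (setOfClasses hL S) (periodicExtend hL u) := fun S =>
    exists_isMinOn_relaxedPeriodicEnergy hV hVc hL (isPeriodicSet_setOfClasses hL S)
  choose u₀ hu₀ using hmin
  obtain ⟨S₀, -, hS₀⟩ := Finset.exists_min_image Finset.univ
    (fun S => relaxedPeriodicEnergy V L (setOfClasses hL S) (periodicExtend hL (u₀ S)))
    Finset.univ_nonempty
  refine ⟨setOfClasses hL S₀, periodicExtend hL (u₀ S₀), isPeriodicSet_setOfClasses hL S₀,
    isPeriodic_periodicExtend hL _, fun X' y' hX' hy' => ?_⟩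
  rw [hX'.eq_setOfClasses hL, ← hy'.periodicExtend_eq hL]
  exact (hS₀ (cellClasses L X') (Finset.mem_univ _)).trans (hu₀ _ _)

end Existence

section Continuous

/-- **Theorem 1.2 from (44) alone, for continuous potentials.** For `V` satisfying (1)–(5) and
continuous on `[0, ∞)` the existence of a relaxed minimizer is a theorem
(`exists_isRelaxedMinimizer`), so the periodic main estimate (44) by itself yields, for every
ground state `y` of `E_L^per` over `Y_L^per`, (42), (43) and `RΩ + τ = A₂` for
`Ω = {y(x) | x ∈ A₂}`. [cite: Theil2006, §3 Proof of Theorem 1.2 (preprint pp. 13–14)] -/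
theorem exists_rotation_range_eq_of_mainEstimate_of_continuousOn :
    ∃ α₀ : ℝ, 0 < α₀ ∧ α₀ < 1 / 3 ∧ ∀ α : ℝ, 0 < α → α < α₀ → ∀ L : ℕ, 0 < L →
      ∀ V : ℝ → ℝ, IsAdmissible α V → ContinuousOn V (Ici 0) → ∀ C : ℝ, 0 < C →
        (∀ (X : Set (ℤ × ℤ)) (y : ℤ × ℤ → Plane), IsPeriodicSet L X → IsPeriodic L y →
            (∀ x ∈ X, ∀ x' ∈ X, x ≠ x' → 1 - α < dist (y x) (y x')) →
              mainEstimateRHS C α V L X y ≤ relaxedPeriodicEnergy V L X y / 2) →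
          ∀ y : ℤ × ℤ → Plane, IsPeriodic L y →
            (∀ y' : ℤ × ℤ → Plane, IsPeriodic L y' → periodicEnergy V L y ≤ periodicEnergy V L y') →
              (∀ x x', y x ≠ y x' → 1 ≤ dist (y x) (y x')) ∧
                (∀ x, {p ∈ Set.range y | dist (y x) p ≤ 1}.ncard = 7) ∧
                  ∃ R : Plane ≃ₗᵢ[ℝ] Plane,
                    LinearMap.det (R.toLinearEquiv : Plane →ₗ[ℝ] Plane) = 1 ∧
                      ∃ τ : Plane, Set.range (fun k => R (y k) + τ) = triangularLattice := by
  obtain ⟨α₀, hα₀, hα₀', h⟩ := exists_rotation_range_eq_of_mainEstimate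
  exact ⟨α₀, hα₀, hα₀', fun α hα hα' L hL V hV hVc C hC h44 y hy hground =>
    h α hα hα' L hL V hV C hC h44 (exists_isRelaxedMinimizer hV hVc hL) y hy hground⟩

end Continuous

end Theil2006

open Theil2006

/-- **Theorem 1.2 (corrected: up to a rigid motion) reduced to the periodic main estimate (44).**
The named fact `Theil2006_periodicGroundStates_upToRotation` (`Theil2006Periodic.lean`: the
conclusion "`RΩ + τ = A₂`" that the printed proof establishes) follows from the two displayed
claims of §3 that the tree does not yet prove: (44) — the periodic version of the main estimate
(9), "the proof of Theorem 1.1 can be adapted to the periodic setting by simply replacing the sets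
`X`, `∂X`, `𝒮`, `𝒯_λ` with the corresponding quotient sets" (its proof is that of (9): Lemma 2.7,
Propositions 2.8/2.9, the resummation (29)–(41) and the rigidity estimates of the Appendix) — and
the existence of a minimizer of the relaxed periodic problem (p. 13, asserted there without proof;
for the real-valued potentials of `Theil2006.lean`, which (2)–(3) do not require to be continuous
at `1 − α`, the relaxed energy need not be lower semicontinuous, so we keep the printed assertion
as a hypothesis rather than a lemma). Everything else of the printed proof of Theorem 1.2 —
Lemma 3.1, the identity competitor, the vanishing argument, (42)–(43) and the characterization
of `A₂` — is proved in the tree (`exists_rotation_range_eq_of_mainEstimate`).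
[cite: Theil2006, §3 Proof of Theorem 1.2 (preprint pp. 13–14)] -/
theorem Theil2006_periodicGroundStates_upToRotation_of_mainEstimate
    (h44 : ∃ α₁ : ℝ, 0 < α₁ ∧ ∀ α : ℝ, 0 < α → α < α₁ → ∀ L : ℕ, 0 < L → ∀ V : ℝ → ℝ,
      IsAdmissible α V → ∃ C : ℝ, 0 < C ∧
        ∀ (X : Set (ℤ × ℤ)) (y : ℤ × ℤ → Plane), IsPeriodicSet L X → IsPeriodic L y →
          (∀ x ∈ X, ∀ x' ∈ X, x ≠ x' → 1 - α < dist (y x) (y x')) →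
            mainEstimateRHS C α V L X y ≤ relaxedPeriodicEnergy V L X y / 2)
    (hex : ∃ α₂ : ℝ, 0 < α₂ ∧ ∀ α : ℝ, 0 < α → α < α₂ → ∀ L : ℕ, 0 < L → ∀ V : ℝ → ℝ,
      IsAdmissible α V → ∃ (X₀ : Set (ℤ × ℤ)) (y₀ : ℤ × ℤ → Plane), IsRelaxedMinimizer V L X₀ y₀) :
    Theil2006_periodicGroundStates_upToRotation := by
  obtain ⟨α₀, hα₀, hα₀', hmain⟩ := exists_rotation_range_eq_of_mainEstimate
  obtain ⟨α₁, hα₁, h44⟩ := h44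
  obtain ⟨α₂, hα₂, hex⟩ := hex
  refine ⟨min α₀ (min α₁ α₂), lt_min hα₀ (lt_min hα₁ hα₂), (min_le_left _ _).trans_lt hα₀',
    fun α hα hα' L hL V hV y hy hground => ?_⟩
  have hα0 : α < α₀ := hα'.trans_le (min_le_left _ _)
  have hα1 : α < α₁ := hα'.trans_le ((min_le_right _ _).trans (min_le_left _ _))
  have hα2 : α < α₂ := hα'.trans_le ((min_le_right _ _).trans (min_le_right _ _))
  obtain ⟨C, hC, h44'⟩ := h44 α hα hα1 L hL V hV
  obtain ⟨-, -, R, -, τ, hτ⟩ := hmain α hα hα0 L hL V hV C hC h44' (hex α hα hα2 L hL V hV) y hy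
    hground
  exact ⟨R, τ, hτ⟩

end Literature.MathematicalPhysics.StatisticalMechanics

end
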